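import Literature.IUT.HodgeTheaters.GlobalFrobenioidRigidity
import HarnessLib

/-!
# [IUTchI] Corollary 5.3 (i): consistency and independence over the hypothesis kit — proof-only companion of `GlobalFrobenioidRigidity`

Mochizuki, *Inter-universal Teichmüller theory I*, kurims manuscript (May 2020), §5, Corollary 5.3
(i), p. 144: *"For `i = 1, 2`, let `ⁱℱ^⊛` (respectively, `ⁱℱ^⊚`) be a category which is equivalent to the
category `†ℱ^⊛` (respectively, `†ℱ^⊚`) of Example 5.1, (iii) … Then the natural map
`Isom(¹ℱ^⊛, ²ℱ^⊛) → Isom(Base(¹ℱ^⊛), Base(²ℱ^⊛))` (respectively, …) is bijective"*; proof p. 144: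
*"Assertion (i) follows immediately from the category-theoreticity of the 'isomorphism
`𝕄^⊛(†𝒟^⊚) ⥲ †𝕄^⊛`' of Example 5.1, (v)"* ([IUTchI] Cor 5.3 (i) p.144) [claim: Mochizuki2012, status: disputed].
Node `IUTchI:Cor5.3(i)`; statement = the named `Prop` `PMBaseKit.S5GlobalLocal.IsomGlobalToBaseBijective`
of `GlobalFrobenioidRigidity.lean` (seat abc-iut-L5-t4), typed over the hypothesis kit `S5GlobalLocal`
(TODO-merge:abc-iut-L5-t1 Ex 5.1 (iii)) whose `baseMap` is an opaque map on isomorphisms.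

WHAT IS PROVED.  Over that kit `baseMap` carries no composition law, so the reduction to the
"model case" is proved UNDER explicit functoriality hypotheses on `Base(−)` (composition, inverses):
`isomGlobalToBaseBijective_of_model` / `model_bijective_of_isomGlobalToBaseBijective` — what remains
is the model case, the category-theoreticity input of Example 5.1 (v), a hypothesis.  Unconditionally,
the honest kernel content available before the kit is instantiated on abc-iut-L5-t1's global
Frobenioids is: CONSISTENCY — the statement HOLDS for the kit's own inhabitant
`S5GlobalLocal.toy` (`Base = id`) —, and INDEPENDENCE — it FAILS for another inhabitant (one object
with automorphism group `ℤ/2`, `baseMap` constant), so it is not a consequence of the kit axioms and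
carries exactly the content the print attributes to the category-theoreticity of [FrdI] Thm 3.4 /
Cor 4.11 and Example 5.1 (v).  No new definitions (the failing inhabitant is built inside the proof);
no side taken on [IUTchIII] Cor. 3.12; typed ≠ discharged.
-/

namespace Literature.IUT.HodgeTheaters

open CategoryTheory

universe u

namespace PMBaseKit

namespace S5GlobalLocal

/-- CONSISTENCY of Cor 5.3 (i) as typed: `IsomGlobalToBaseBijective` holds for the kit's inhabitant
`S5GlobalLocal.toy` (there `Base(−)` is the identity and `baseMap` the identity on isomorphisms).
([IUTchI] Cor 5.3 (i) p.144) [claim: Mochizuki2012, status: disputed] -/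
theorem isomGlobalToBaseBijective_toy : S5GlobalLocal.toy.IsomGlobalToBaseBijective :=
  ⟨fun _ _ _ _ => Function.bijective_id, fun _ _ _ _ => Function.bijective_id⟩

/-- INDEPENDENCE of Cor 5.3 (i) from the kit axioms: there is an inhabitant of `S5GlobalLocal` (the
one-object category with automorphism group `ℤ/2` as both `†ℱ^⊛` and `†ℱ^⊚`, `Base = id`, `baseMap`
constant with value the identity) for which `IsomGlobalToBaseBijective` FAILS — both the `ℱ^⊛`- and
the `ℱ^⊚`-clause.  ([IUTchI] Cor 5.3 (i) p.144) [claim: Mochizuki2012, status: disputed] -/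
theorem exists_not_isomGlobalToBaseBijective :
    ∃ G : S5GlobalLocal.{0}, ¬ G.IsomGlobalToBaseBijective ∧
      ¬ (∀ Y₁ Y₂ : G.CatAmb, Nonempty (Y₁ ≅ G.FnfModel) → Nonempty (Y₂ ≅ G.FnfModel) →
          Function.Bijective (G.baseMap (Y₁ := Y₁) (Y₂ := Y₂))) := by
  let G : S5GlobalLocal.{0} :=
    { CatAmb := SingleObj (Multiplicative (ZMod 2))
      FglobModel := SingleObj.star _
      FnfModel := SingleObj.star _
      base := fun Y => Y
      baseMap := fun {Y₁ Y₂} _ => eqToIso rfl }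
  have key : ¬ ∀ Y₁ Y₂ : G.CatAmb, Nonempty (Y₁ ≅ G.FnfModel) → Nonempty (Y₂ ≅ G.FnfModel) →
      Function.Bijective (G.baseMap (Y₁ := Y₁) (Y₂ := Y₂)) := by
    intro h
    have hb := h G.FnfModel G.FnfModel ⟨Iso.refl _⟩ ⟨Iso.refl _⟩
    -- the automorphism `σ` (generator of `ℤ/2`) of the unique object is not in the image of the
    -- constant map `baseMap`
    obtain ⟨φ, hφ⟩ := hb.2 ⟨Multiplicative.ofAdd (1 : ZMod 2), Multiplicative.ofAdd (1 : ZMod 2),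
      by change Multiplicative.ofAdd (1 : ZMod 2) * Multiplicative.ofAdd (1 : ZMod 2) = 1; decide,
      by change Multiplicative.ofAdd (1 : ZMod 2) * Multiplicative.ofAdd (1 : ZMod 2) = 1; decide⟩
    have h1 : (1 : Multiplicative (ZMod 2)) = Multiplicative.ofAdd (1 : ZMod 2) := congrArg Iso.hom hφ
    exact absurd h1 (by decide)
  exact ⟨G, fun h => key h.1, key⟩

/-! ### Reduction to the model case under functoriality of `Base(−)` -/

/-- Conjugation to the model (the global analogue of `FKit.mapIso_bijective_of_model`): if `Base(−)` on
isomorphisms respects composition and inverses, and `Isom(Y₀, Y₀) → Isom(Base Y₀, Base Y₀)` is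
bijective for the MODEL `Y₀`, then `Isom(Y₁, Y₂) → Isom(Base Y₁, Base Y₂)` is bijective for all
isomorphs `Y₁ ≅ Y₀ ≅ Y₂`.  (The laws are the content of "natural map" in Cor 5.3 (i), [FrdI] Cor 4.11 /
Thm 6.4 (i): `Base(−)` is functorial; the kit `S5GlobalLocal` does not record them, so they enter as
hypotheses.) ([IUTchI] Cor 5.3 (i) p.144) [claim: Mochizuki2012, status: disputed] -/
theorem baseMap_bijective_of_model (G : S5GlobalLocal.{u})
    (htrans : ∀ {Y₁ Y₂ Y₃ : G.CatAmb} (e : Y₁ ≅ Y₂) (f : Y₂ ≅ Y₃),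
      G.baseMap (e ≪≫ f) = G.baseMap e ≪≫ G.baseMap f)
    (hsymm : ∀ {Y₁ Y₂ : G.CatAmb} (e : Y₁ ≅ Y₂), G.baseMap e.symm = (G.baseMap e).symm)
    {Y₀ : G.CatAmb} (h : Function.Bijective (G.baseMap (Y₁ := Y₀) (Y₂ := Y₀)))
    {Y₁ Y₂ : G.CatAmb} (e₁ : Y₁ ≅ Y₀) (e₂ : Y₂ ≅ Y₀) :
    Function.Bijective (G.baseMap (Y₁ := Y₁) (Y₂ := Y₂)) := by
  have key : ∀ φ : Y₁ ≅ Y₂, e₁ ≪≫ (e₁.symm ≪≫ φ ≪≫ e₂) ≪≫ e₂.symm = φ := fun φ => by ext; simp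
  constructor
  · intro φ₁ φ₂ hφ
    have h' : G.baseMap (e₁.symm ≪≫ φ₁ ≪≫ e₂) = G.baseMap (e₁.symm ≪≫ φ₂ ≪≫ e₂) := by
      rw [htrans, htrans, htrans, htrans, hφ]
    have h2 := h.1 h'
    rw [← key φ₁, ← key φ₂, h2]
  · intro ψ
    obtain ⟨α, hα⟩ := h.2 ((G.baseMap e₁).symm ≪≫ ψ ≪≫ G.baseMap e₂)
    refine ⟨e₁ ≪≫ α ≪≫ e₂.symm, ?_⟩
    rw [htrans, htrans, hsymm, hα]
    ext; simp

/-- **Cor 5.3 (i) from its model case, under functoriality of `Base(−)`**: if `Base(−)` respects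
composition and inverses of isomorphisms and the natural maps `Isom(†ℱ^⊛, †ℱ^⊛) → Isom(Base, Base)`,
`Isom(†ℱ^⊚, †ℱ^⊚) → Isom(Base, Base)` are bijective for the MODEL global Frobenioids of Example 5.1 (iii),
then `IsomGlobalToBaseBijective` holds (all categories equivalent to the models).  The model case is
where the printed input — category-theoreticity of `𝕄^⊛(†𝒟^⊚) ⥲ †𝕄^⊛`, Example 5.1 (v) — enters; it is a
hypothesis here. ([IUTchI] Cor 5.3 (i) p.144) [claim: Mochizuki2012, status: disputed] -/
theorem isomGlobalToBaseBijective_of_model (G : S5GlobalLocal.{u})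
    (htrans : ∀ {Y₁ Y₂ Y₃ : G.CatAmb} (e : Y₁ ≅ Y₂) (f : Y₂ ≅ Y₃),
      G.baseMap (e ≪≫ f) = G.baseMap e ≪≫ G.baseMap f)
    (hsymm : ∀ {Y₁ Y₂ : G.CatAmb} (e : Y₁ ≅ Y₂), G.baseMap e.symm = (G.baseMap e).symm)
    (hglob : Function.Bijective (G.baseMap (Y₁ := G.FglobModel) (Y₂ := G.FglobModel)))
    (hnf : Function.Bijective (G.baseMap (Y₁ := G.FnfModel) (Y₂ := G.FnfModel))) :
    G.IsomGlobalToBaseBijective :=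
  ⟨fun _ _ h₁ h₂ => G.baseMap_bijective_of_model htrans hsymm hglob h₁.some h₂.some,
    fun _ _ h₁ h₂ => G.baseMap_bijective_of_model htrans hsymm hnf h₁.some h₂.some⟩

/-- Conversely (no laws needed), `IsomGlobalToBaseBijective` contains its model case.
([IUTchI] Cor 5.3 (i) p.144) [claim: Mochizuki2012, status: disputed] -/
theorem model_bijective_of_isomGlobalToBaseBijective (G : S5GlobalLocal.{u})
    (h : G.IsomGlobalToBaseBijective) :
    Function.Bijective (G.baseMap (Y₁ := G.FglobModel) (Y₂ := G.FglobModel)) ∧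
      Function.Bijective (G.baseMap (Y₁ := G.FnfModel) (Y₂ := G.FnfModel)) :=
  ⟨h.1 _ _ ⟨Iso.refl _⟩ ⟨Iso.refl _⟩, h.2 _ _ ⟨Iso.refl _⟩ ⟨Iso.refl _⟩⟩

end S5GlobalLocal

end PMBaseKit

end Literature.IUT.HodgeTheaters
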